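import Literature.NumberTheory.EllipticCurves.KubertTateThirteen
import Literature.NumberTheory.EllipticCurves.VariableChangePointsMap
import HarnessLib

/-!
# The universal elliptic curve with a point of order `7`: `E(d³ - d², d² - d)` (Kubert, Table 3)
# and its integral model `[n² + mn - m², m²n(n - m), m²n³(n - m), 0, 0]`

Topic `NumberTheory/EllipticCurves`; continues `Literature.NumberTheory.EllipticCurves.KubertTateNormalForm`
(the Tate normal form `E(b, c) : y² + (1 - c)xy - by = x³ - bx²` with marked point `P = (0, 0)`,
`-P = (0, b)`, `2P = (b, bc)`, `3P = (c, b - c)`, Knapp §V.5 (5.30)), `KubertTateThirteen` (the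
multiples `4P, 5P, 6P` in Sutherland's coordinates `b = rs(r - 1)`, `c = s(r - 1)`) and the sibling
`KubertTateFive` (the universal `5`-torsion curve `E(t, t)` and its integral model). Everything here
is PROVED; nothing is a named fact.

Kubert 1976, Table 3, `N = 7`: the pairs (elliptic curve, point of order `7`) over a field are the
`(E(b, c), (0, 0))` with `b = d³ - d²`, `c = d² - d` (`X₁(7) ≅ ℙ¹`, coordinate `d`); in Sutherland's
coordinates (`b = rs(r - 1)`, `c = s(r - 1)`, Sutherland 2012 §2) this is the DIAGONAL `r = s = d`,
on which `x(6P) = s(r - 1)(r - s)/(s - 1)² = 0`, i.e. `6P = -P`, `7P = 𝒪`. This file records: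

* `kubertTate_diag₇_six_nsmul_zero`, **`kubertTate_diag₇_seven_nsmul_zero`** — on
  `E(d·d·(d - 1), d(d - 1))` with `(0, 0)` nonsingular (`d ≠ 0, 1`): `6 · (0,0) = -(0,0)` and
  `7 · (0,0) = 𝒪`, from the tree's `kubertTate_six_nsmul_zero` (Sutherland's `x₆, y₆`) at `r = s`;
  hence `addOrderOf_kubertTate_diag₇_zero` : the marked point has order EXACTLY `7`, and
  `exists_addOrderOf_eq_seven_kubertTate_diag₇`;
* the invariants: `kubertTate_diag₇_Δ` : `Δ = d⁷(d - 1)⁷(d³ - 8d² + 5d + 1)`, `kubertTate_diag₇_c₄`,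
  `isElliptic_kubertTate_diag₇`;
* the INTEGRAL MODEL `kubertTateSeven m n := [n² + mn - m², m²n(n - m), m²n³(n - m), 0, 0]` (the
  scaling `u = n⁻²` of `E(d³ - d², d² - d)`, `d = m/n`, `kubertTateSeven_eq_variableChange_kubertTate`),
  with `kubertTateSeven_Δ` : **`Δ = m⁷n⁷(m - n)⁷(m³ - 8m²n + 5mn² + n³)`**, `kubertTateSeven_c₄`, its
  marked point `(0, 0)` of order exactly `7` (`addOrderOf_kubertTateSeven_zero`,
  `exists_addOrderOf_eq_seven_kubertTateSeven`) and `isElliptic_kubertTateSeven` — the model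
  `E_d`, `d = m/n`, in which the `X₁(7)`-family enters the `7`-descent (T. Fisher, *Some examples of
  5 and 7 descent for elliptic curves over ℚ*, JEMS 3 (2001), §§1–2; the sequel files
  `KubertTateSevenVeluIsogeny`, `KubertTateSevenKummerValuation` carry out the `7`-isogeny descent on
  this model exactly as `KubertTateFiveVeluIsogeny`, `KubertTateFiveKummerValuation` do at `5`).

## References

* [Kubert1976] D. S. Kubert, *Universal bounds on the torsion of elliptic curves*, Proc. London
  Math. Soc. (3) 33 (1976) 193–237, Table 3 (`N = 7`: `b = d³ - d²`, `c = d² - d`).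
* [Knapp1993] A. W. Knapp, *Elliptic Curves*, Mathematical Notes 40, Princeton UP (1992), §V.5
  (5.30a/b) (held PDF pp. 110–111).
* [Sutherland2012] A. V. Sutherland, *Constructing elliptic curves over finite fields with
  prescribed torsion*, Math. Comp. 81 (2012) 1131–1147, §2 (`b = rs(r-1)`, `c = s(r-1)`; table of
  `xₙ`; raw form of `X₁(7)`: `r = s`).
* [Fisher2001FiveSevenDescent] T. Fisher, *Some examples of 5 and 7 descent for elliptic curves
  over ℚ*, J. Eur. Math. Soc. 3 (2001) 169–201, §§1–2.
* [SilvermanAEC2009] J. H. Silverman, *The Arithmetic of Elliptic Curves*, 2nd ed., III.1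
  Table 3.1 (admissible changes of variables; `u⁻ⁱ aᵢ` under a pure scaling).

## Design choices

* Same conventions as `KubertTateFive`: dot-notation-style extension of Mathlib's `WeierstrassCurve`
  namespace, general field with `[DecidableEq F]` for point statements. The one-parameter curve is
  written `kubertTate (d * d * (d - 1)) (d * (d - 1))`, LITERALLY Sutherland's `E(rs(r-1), s(r-1))`
  at `r = s = d`, so that the tree's `kubertTate_six_nsmul_zero` applies without rewriting.
* The integral model is a definition over any commutative ring (so that `ℤ`-models and their
  `map (Int.castRingHom ℚ)` are literally `kubertTateSeven`), related to the one-parameter curve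
  over a field by an explicit `VariableChange` (`u = (n²)⁻¹`) and the tree's
  `VariableChange.pointEquiv` / `Affine.Point.congrEquiv` (orders of points transfer along group
  isomorphisms).
-/

noncomputable section

namespace WeierstrassCurve

/-! ### Invariants of `E(d³ - d², d² - d)` and the integral model -/

section Ring

variable {R : Type*} [CommRing R]

/-- **`Δ(E(d³ - d², d² - d)) = d⁷ (d - 1)⁷ (d³ - 8d² + 5d + 1)`** (specialise Knapp's `Δ(b, c)` to
`b = d·d·(d - 1)`, `c = d(d - 1)`). [cite: Kubert1976, Table 3 (N = 7); Knapp1993, §V.5 p. 147 (Δ(b,c))] -/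
theorem kubertTate_diag₇_Δ (d : R) :
    (kubertTate (d * d * (d - 1)) (d * (d - 1))).Δ =
      d ^ 7 * (d - 1) ^ 7 * (d ^ 3 - 8 * d ^ 2 + 5 * d + 1) := by
  rw [kubertTate_Δ]
  ring

/-- `c₄(E(d³ - d², d² - d)) = (d² - d + 1)(d⁶ - 11d⁵ + 30d⁴ - 15d³ - 10d² + 5d + 1)`.
[cite: Kubert1976, Table 3 (N = 7); SilvermanAEC2009 III.1 (c₄)] -/
theorem kubertTate_diag₇_c₄ (d : R) :
    (kubertTate (d * d * (d - 1)) (d * (d - 1))).c₄ =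
      (d ^ 2 - d + 1) * (d ^ 6 - 11 * d ^ 5 + 30 * d ^ 4 - 15 * d ^ 3 - 10 * d ^ 2 + 5 * d + 1) := by
  simp only [kubertTate, c₄, b₂, b₄]
  ring

/-- **The integral model of `E(d³ - d², d² - d)`, `d = m/n`:**
`[a₁, a₂, a₃, a₄, a₆] = [n² + mn - m², m²n(n - m), m²n³(n - m), 0, 0]`, i.e.
`y² + (n² + mn - m²)xy + m²n³(n - m)y = x³ + m²n(n - m)x²`, the pure scaling `u = n⁻²` of
`E(d³ - d², d² - d)` (`kubertTateSeven_eq_variableChange_kubertTate`); marked point `(0, 0)`.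
[cite: Kubert1976, Table 3 (N = 7)] -/
def kubertTateSeven (m n : R) : WeierstrassCurve R where
  a₁ := n ^ 2 + m * n - m ^ 2
  a₂ := m ^ 2 * n * (n - m)
  a₃ := m ^ 2 * n ^ 3 * (n - m)
  a₄ := 0
  a₆ := 0

variable (m n : R)

/-- `a₁ = n² + mn - m²` (by definition). [cite: Kubert1976, Table 3 (N = 7)] -/
@[simp] theorem kubertTateSeven_a₁ : (kubertTateSeven m n).a₁ = n ^ 2 + m * n - m ^ 2 := rfl

/-- `a₂ = m²n(n - m)` (by definition). [cite: Kubert1976, Table 3 (N = 7)] -/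
@[simp] theorem kubertTateSeven_a₂ : (kubertTateSeven m n).a₂ = m ^ 2 * n * (n - m) := rfl

/-- `a₃ = m²n³(n - m)` (by definition). [cite: Kubert1976, Table 3 (N = 7)] -/
@[simp] theorem kubertTateSeven_a₃ : (kubertTateSeven m n).a₃ = m ^ 2 * n ^ 3 * (n - m) := rfl

/-- `a₄ = 0` (by definition). [cite: Kubert1976, Table 3 (N = 7)] -/
@[simp] theorem kubertTateSeven_a₄ : (kubertTateSeven m n).a₄ = 0 := rfl

/-- `a₆ = 0` (by definition). [cite: Kubert1976, Table 3 (N = 7)] -/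
@[simp] theorem kubertTateSeven_a₆ : (kubertTateSeven m n).a₆ = 0 := rfl

/-- `n = 1` gives back the Tate normal form `E(d³ - d², d² - d)` (written `E(d·d·(d-1), d(d-1))`).
[cite: Kubert1976, Table 3 (N = 7)] -/
theorem kubertTateSeven_one_right (d : R) :
    kubertTateSeven d 1 = kubertTate (d * d * (d - 1)) (d * (d - 1)) := by
  ext <;> simp [kubertTateSeven, kubertTate] <;> ring

/-- The integral model commutes with ring homomorphisms (e.g. `ℤ → ℚ`). [cite: Kubert1976, Table 3 (N = 7)] -/
theorem map_kubertTateSeven {S : Type*} [CommRing S] (f : R →+* S) :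
    (kubertTateSeven m n).map f = kubertTateSeven (f m) (f n) := by
  ext <;> simp [kubertTateSeven, map]

/-- **`Δ = m⁷ n⁷ (m - n)⁷ (m³ - 8m²n + 5mn² + n³)`** for the integral model.
[cite: Kubert1976, Table 3 (N = 7); Knapp1993, §V.5 p. 147 (Δ(b,c))] -/
theorem kubertTateSeven_Δ :
    (kubertTateSeven m n).Δ =
      m ^ 7 * n ^ 7 * (m - n) ^ 7 * (m ^ 3 - 8 * m ^ 2 * n + 5 * m * n ^ 2 + n ^ 3) := by
  simp only [kubertTateSeven, Δ, b₂, b₄, b₆, b₈]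
  ring

/-- `c₄ = (m² - mn + n²)(m⁶ - 11m⁵n + 30m⁴n² - 15m³n³ - 10m²n⁴ + 5mn⁵ + n⁶)` for the integral model.
[cite: Kubert1976, Table 3 (N = 7); SilvermanAEC2009 III.1 (c₄)] -/
theorem kubertTateSeven_c₄ :
    (kubertTateSeven m n).c₄ = (m ^ 2 - m * n + n ^ 2) *
      (m ^ 6 - 11 * m ^ 5 * n + 30 * m ^ 4 * n ^ 2 - 15 * m ^ 3 * n ^ 3 - 10 * m ^ 2 * n ^ 4
        + 5 * m * n ^ 5 + n ^ 6) := by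
  simp only [kubertTateSeven, c₄, b₂, b₄]
  ring

/-- The marked point `(0, 0)` lies on the integral model (`a₆ = 0`). [cite: Knapp1993, §V.5 (5.27)] -/
theorem kubertTateSeven_equation_zero : (kubertTateSeven m n).toAffine.Equation 0 0 := by
  rw [Affine.equation_zero]
  rfl

/-- `(0, 0)` is nonsingular on the integral model iff `a₃ = m²n³(n - m) ≠ 0`. [cite: Knapp1993, §V.5 (5.27)] -/
theorem kubertTateSeven_nonsingular_zero_iff :
    (kubertTateSeven m n).toAffine.Nonsingular 0 0 ↔ m ^ 2 * n ^ 3 * (n - m) ≠ 0 := by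
  rw [Affine.nonsingular_zero]
  simp only [kubertTateSeven, ne_eq, not_true_eq_false, or_false, true_and]

/-- `(0, 0)` is nonsingular on the integral model when `m ≠ 0`, `n ≠ 0`, `m ≠ n` (over a domain).
[cite: Knapp1993, §V.5 (5.27)] -/
theorem kubertTateSeven_nonsingular_zero [IsDomain R] {m n : R} (hm : m ≠ 0) (hn : n ≠ 0)
    (hmn : m ≠ n) : (kubertTateSeven m n).toAffine.Nonsingular 0 0 :=
  (kubertTateSeven_nonsingular_zero_iff m n).mpr
    (mul_ne_zero (mul_ne_zero (pow_ne_zero 2 hm) (pow_ne_zero 3 hn)) (sub_ne_zero.mpr hmn.symm))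

end Ring

/-! ### Kubert, Table 3 (`N = 7`): on the diagonal `r = s`, `6P = -P` and `7P = 𝒪` -/

section Field

variable {F : Type*} [Field F] [DecidableEq F]

omit [DecidableEq F] in
/-- Two affine points with equal coordinates are equal (proof-irrelevance helper). [folklore] -/
private theorem kubertTateSeven_point_congr_coords {W : WeierstrassCurve F} {x y x' y' : F}
    {h : W.toAffine.Nonsingular x y} {h' : W.toAffine.Nonsingular x' y'} (hx : x = x') (hy : y = y') :
    (Affine.Point.some x y h : W.toAffine.Point) = Affine.Point.some x' y' h' := by
  subst hx hy
  rfl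

omit [DecidableEq F] in
/-- On `E(d·d·(d-1), d(d-1))`, `(0, 0)` nonsingular forces `d ≠ 0` and `d ≠ 1` (`b = d²(d-1) ≠ 0`).
[cite: Knapp1993, §V.5 (5.27)] -/
theorem kubertTate_diag₇_ne_of_nonsingular {d : F}
    (h : (kubertTate (d * d * (d - 1)) (d * (d - 1))).toAffine.Nonsingular 0 0) : d ≠ 0 ∧ d ≠ 1 := by
  have hb : d * d * (d - 1) ≠ 0 := (kubertTate_nonsingular_zero_iff _ _).mp h
  refine ⟨fun h0 => hb ?_, fun h1 => hb ?_⟩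
  · rw [h0]; ring
  · rw [h1]; ring

/-- **`6P = -P`** for `P = (0, 0)` on `E(d³ - d², d² - d) = E(rs(r-1), s(r-1))|_{r = s = d}`:
Sutherland's `6P = (s(r-1)(r-s)/(s-1)², s²(r-1)²(rs-2r+1)/(s-1)³)` at `r = s` is `(0, d²(d-1)) = (0, b)
= -P` (Knapp (5.30a)). [cite: Sutherland2012, §2 (x₆; raw form of X₁(7): r = s); Kubert1976, Table 3 (N = 7)] -/
theorem kubertTate_diag₇_six_nsmul_zero (d : F)
    (h : (kubertTate (d * d * (d - 1)) (d * (d - 1))).toAffine.Nonsingular 0 0) :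
    6 • (Affine.Point.some 0 0 h : (kubertTate (d * d * (d - 1)) (d * (d - 1))).toAffine.Point) =
      -(Affine.Point.some 0 0 h) := by
  obtain ⟨hd, hd₁⟩ := kubertTate_diag₇_ne_of_nonsingular h
  have hd₁' : d - 1 ≠ 0 := sub_ne_zero.mpr hd₁
  obtain ⟨h₆, e₆⟩ := kubertTate_six_nsmul_zero d d h hd hd₁ hd hd₁
  rw [e₆, kubertTate_neg_zero]
  apply kubertTateSeven_point_congr_coords
  · rw [sub_self, mul_zero, zero_div]
  · field_simp
    ring

/-- **`7P = 𝒪`** for `P = (0, 0)` on `E(d³ - d², d² - d)` (`7P = 6P + P = -P + P`).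
[cite: Kubert1976, Table 3 (N = 7); Sutherland2012, §2 (raw form of X₁(7): r = s)] -/
theorem kubertTate_diag₇_seven_nsmul_zero (d : F)
    (h : (kubertTate (d * d * (d - 1)) (d * (d - 1))).toAffine.Nonsingular 0 0) :
    7 • (Affine.Point.some 0 0 h : (kubertTate (d * d * (d - 1)) (d * (d - 1))).toAffine.Point) = 0 := by
  rw [show (7 : ℕ) = 6 + 1 from rfl, succ_nsmul, kubertTate_diag₇_six_nsmul_zero d h, neg_add_cancel]

/-- **On `E(d³ - d², d² - d)` (`d ≠ 0, 1`) the marked point `(0, 0)` has order exactly `7`.**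
[cite: Kubert1976, Table 3 (N = 7)] -/
theorem addOrderOf_kubertTate_diag₇_zero (d : F)
    (h : (kubertTate (d * d * (d - 1)) (d * (d - 1))).toAffine.Nonsingular 0 0) :
    addOrderOf (Affine.Point.some 0 0 h : (kubertTate (d * d * (d - 1)) (d * (d - 1))).toAffine.Point) = 7 :=
  haveI : Fact (Nat.Prime 7) := ⟨by decide⟩
  addOrderOf_eq_prime (kubertTate_diag₇_seven_nsmul_zero d h) (Affine.Point.some_ne_zero h)

/-- `E(d³ - d², d² - d)` with `d ≠ 0, 1` carries a point of order `7` (the binder shape of consumers).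
[cite: Kubert1976, Table 3 (N = 7)] -/
theorem exists_addOrderOf_eq_seven_kubertTate_diag₇ {d : F} (hd : d ≠ 0) (hd₁ : d ≠ 1) :
    ∃ P : (kubertTate (d * d * (d - 1)) (d * (d - 1))).toAffine.Point, addOrderOf P = 7 :=
  ⟨_, addOrderOf_kubertTate_diag₇_zero d ((kubertTate_nonsingular_zero_iff _ _).mpr
    (mul_ne_zero (mul_ne_zero hd hd) (sub_ne_zero.mpr hd₁)))⟩

/-! ### Ellipticity -/

omit [DecidableEq F] in
/-- `E(d³ - d², d² - d)` is an elliptic curve if `d ≠ 0`, `d ≠ 1` and `d³ - 8d² + 5d + 1 ≠ 0` (and only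
then: `Δ = d⁷(d-1)⁷(d³ - 8d² + 5d + 1)`). [cite: Kubert1976, Table 3 (N = 7); Knapp1993, §V.5 p. 147 (Δ(b,c))] -/
theorem isElliptic_kubertTate_diag₇ {d : F} (hd : d ≠ 0) (hd₁ : d ≠ 1)
    (hq : d ^ 3 - 8 * d ^ 2 + 5 * d + 1 ≠ 0) :
    (kubertTate (d * d * (d - 1)) (d * (d - 1))).IsElliptic := by
  rw [isElliptic_iff, kubertTate_diag₇_Δ]
  exact (mul_ne_zero (mul_ne_zero (pow_ne_zero 7 hd) (pow_ne_zero 7 (sub_ne_zero.mpr hd₁))) hq).isUnit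

omit [DecidableEq F] in
/-- The integral model is an elliptic curve if `m ≠ 0`, `n ≠ 0`, `m ≠ n` and
`m³ - 8m²n + 5mn² + n³ ≠ 0`. [cite: Kubert1976, Table 3 (N = 7); Knapp1993, §V.5 p. 147 (Δ(b,c))] -/
theorem isElliptic_kubertTateSeven {m n : F} (hm : m ≠ 0) (hn : n ≠ 0) (hmn : m ≠ n)
    (hq : m ^ 3 - 8 * m ^ 2 * n + 5 * m * n ^ 2 + n ^ 3 ≠ 0) : (kubertTateSeven m n).IsElliptic := by
  rw [isElliptic_iff, kubertTateSeven_Δ]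
  exact (mul_ne_zero (mul_ne_zero (mul_ne_zero (pow_ne_zero 7 hm) (pow_ne_zero 7 hn))
    (pow_ne_zero 7 (sub_ne_zero.mpr hmn))) hq).isUnit

omit [DecidableEq F] in
/-- Conversely `m ≠ 0`, `n ≠ 0`, `m ≠ n` and `m³ - 8m²n + 5mn² + n³ ≠ 0` when the integral model is
elliptic. [cite: Kubert1976, Table 3 (N = 7); Knapp1993, §V.5 p. 147 (Δ(b,c))] -/
theorem kubertTateSeven_ne_zero_of_isElliptic {m n : F} [hE : (kubertTateSeven m n).IsElliptic] :
    m ≠ 0 ∧ n ≠ 0 ∧ m ≠ n ∧ m ^ 3 - 8 * m ^ 2 * n + 5 * m * n ^ 2 + n ^ 3 ≠ 0 := by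
  have h := hE.isUnit.ne_zero
  rw [kubertTateSeven_Δ] at h
  refine ⟨fun h0 ↦ h ?_, fun h0 ↦ h ?_, fun h0 ↦ h ?_, fun h0 ↦ h ?_⟩
  · rw [h0]; ring
  · rw [h0]; ring
  · rw [h0]; ring
  · rw [h0]; ring

/-! ### The integral model is a scaling of `E(d³ - d², d² - d)`; its marked point has order `7` -/

omit [DecidableEq F] in
/-- **`[n² + mn - m², m²n(n-m), m²n³(n-m), 0, 0] = (u = n⁻²) • E(d³ - d², d² - d)`, `d = m/n`** (a pure
scaling: `aᵢ ↦ n²ⁱ aᵢ`, Silverman III.1 Table 3.1). [cite: SilvermanAEC2009, III.1 Table 3.1; Kubert1976, Table 3 (N = 7)] -/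
theorem kubertTateSeven_eq_variableChange_kubertTate {m n : F} (hn : n ≠ 0) :
    kubertTateSeven m n =
      (⟨(Units.mk0 (n ^ 2) (pow_ne_zero 2 hn))⁻¹, 0, 0, 0⟩ : VariableChange F) •
        kubertTate (m / n * (m / n) * (m / n - 1)) (m / n * (m / n - 1)) := by
  ext
  · simp only [variableChange_a₁, kubertTate_a₁, kubertTateSeven_a₁, inv_inv, Units.val_mk0]
    field_simp
    ring
  · simp only [variableChange_a₂, kubertTate_a₁, kubertTate_a₂, kubertTateSeven_a₂, inv_inv,
      Units.val_mk0]
    field_simp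
    ring
  · simp only [variableChange_a₃, kubertTate_a₁, kubertTate_a₃, kubertTateSeven_a₃, inv_inv,
      Units.val_mk0]
    field_simp
    ring
  · simp only [variableChange_a₄, kubertTate_a₁, kubertTate_a₂, kubertTate_a₃, kubertTate_a₄,
      kubertTateSeven_a₄, inv_inv, Units.val_mk0]
    ring
  · simp only [variableChange_a₆, kubertTate_a₁, kubertTate_a₂, kubertTate_a₃, kubertTate_a₄,
      kubertTate_a₆, kubertTateSeven_a₆, inv_inv, Units.val_mk0]
    ring

/-- **On the integral model (`m, n ≠ 0`, `m ≠ n`) the marked point `(0, 0)` has order exactly `7`**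
(transport of `addOrderOf_kubertTate_diag₇_zero` along the scaling isomorphism, which fixes `(0, 0)`).
[cite: Kubert1976, Table 3 (N = 7)] -/
theorem addOrderOf_kubertTateSeven_zero {m n : F} (hm : m ≠ 0) (hn : n ≠ 0) (hmn : m ≠ n)
    (h : (kubertTateSeven m n).toAffine.Nonsingular 0 0) :
    addOrderOf (Affine.Point.some 0 0 h : (kubertTateSeven m n).toAffine.Point) = 7 := by
  set C : VariableChange F := ⟨(Units.mk0 (n ^ 2) (pow_ne_zero 2 hn))⁻¹, 0, 0, 0⟩ with hCdef
  set d : F := m / n with hd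
  have hC : C • kubertTate (d * d * (d - 1)) (d * (d - 1)) = kubertTateSeven m n :=
    (kubertTateSeven_eq_variableChange_kubertTate hn).symm
  have hd0 : d ≠ 0 := div_ne_zero hm hn
  have hd1 : d ≠ 1 := by
    intro h1
    apply hmn
    rw [hd, div_eq_one_iff_eq hn] at h1
    exact h1
  have h₀ : (kubertTate (d * d * (d - 1)) (d * (d - 1))).toAffine.Nonsingular 0 0 :=
    (kubertTate_nonsingular_zero_iff _ _).mpr (mul_ne_zero (mul_ne_zero hd0 hd0) (sub_ne_zero.mpr hd1))
  have himg : Affine.Point.congrEquiv hC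
      (VariableChange.pointEquiv (kubertTate (d * d * (d - 1)) (d * (d - 1))) C (.some 0 0 h₀)) =
        .some 0 0 h := by
    rw [VariableChange.pointEquiv_some, Affine.Point.congrEquiv_some]
    exact kubertTateSeven_point_congr_coords (by simp [VariableChange.toX_def, hCdef])
      (by simp [VariableChange.toY_def, hCdef])
  rw [← himg, AddEquiv.addOrderOf_eq, AddEquiv.addOrderOf_eq]
  exact addOrderOf_kubertTate_diag₇_zero _ h₀

/-- `7 · (0, 0) = 𝒪` on the integral model (`m, n ≠ 0`, `m ≠ n`). [cite: Kubert1976, Table 3 (N = 7)] -/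
theorem kubertTateSeven_seven_nsmul_zero {m n : F} (hm : m ≠ 0) (hn : n ≠ 0) (hmn : m ≠ n)
    (h : (kubertTateSeven m n).toAffine.Nonsingular 0 0) :
    7 • (Affine.Point.some 0 0 h : (kubertTateSeven m n).toAffine.Point) = 0 := by
  rw [← addOrderOf_kubertTateSeven_zero hm hn hmn h]
  exact addOrderOf_nsmul_eq_zero _

/-- The integral model with `m, n ≠ 0`, `m ≠ n` carries a point of order `7` (the binder shape of
consumers). [cite: Kubert1976, Table 3 (N = 7)] -/
theorem exists_addOrderOf_eq_seven_kubertTateSeven {m n : F} (hm : m ≠ 0) (hn : n ≠ 0) (hmn : m ≠ n) :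
    ∃ P : (kubertTateSeven m n).toAffine.Point, addOrderOf P = 7 :=
  ⟨_, addOrderOf_kubertTateSeven_zero hm hn hmn (kubertTateSeven_nonsingular_zero hm hn hmn)⟩

end Field

/-! ### Over `ℚ`: `d³ - 8d² + 5d + 1` has no rational root -/

section Rat

/-- `d³ - 8d² + 5d + 1 ≠ 0` for every rational `d` (rational root test: a root `p/q` in lowest terms
has `q ∣ 1` and `p ∣ 1`, and `±1` are not roots). [cite: Kubert1976, Table 3 (N = 7) (the family over ℚ)] -/
theorem cube_sub_eight_sq_add_five_mul_add_one_ne_zero (d : ℚ) :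
    d ^ 3 - 8 * d ^ 2 + 5 * d + 1 ≠ 0 := by
  intro h
  set p : ℤ := d.num with hp
  set q : ℤ := (d.den : ℤ) with hq
  have hq0 : (q : ℚ) ≠ 0 := by rw [hq]; exact_mod_cast d.den_ne_zero
  have hd : d = p / q := by rw [hp, hq]; exact (Rat.num_div_den d).symm
  have hint : p ^ 3 - 8 * p ^ 2 * q + 5 * p * q ^ 2 + q ^ 3 = 0 := by
    have h' : (p : ℚ) ^ 3 - 8 * (p : ℚ) ^ 2 * q + 5 * p * (q : ℚ) ^ 2 + (q : ℚ) ^ 3 = 0 := by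
      have := congrArg (fun t : ℚ ↦ t * (q : ℚ) ^ 3) h
      simp only [zero_mul] at this
      rw [hd] at this
      field_simp at this
      linear_combination this
    exact_mod_cast h'
  have hcop : IsCoprime p q := by
    rw [hp, hq, Int.isCoprime_iff_gcd_eq_one]
    exact_mod_cast d.reduced
  -- `q ∣ p³` and `p ∣ q³`, so `q ∣ 1` and `p ∣ 1`
  have hq1 : q ∣ 1 := by
    have h3 : q ∣ p ^ 3 := ⟨8 * p ^ 2 - 5 * p * q - q ^ 2, by linear_combination hint⟩
    exact (hcop.symm.pow_right (n := 3)).dvd_of_dvd_mul_left (by simpa using h3)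
  have hp1 : p ∣ 1 := by
    have h3 : p ∣ q ^ 3 := ⟨-(p ^ 2) + 8 * p * q - 5 * q ^ 2, by linear_combination hint⟩
    exact (hcop.pow_right (n := 3)).dvd_of_dvd_mul_left (by simpa using h3)
  have hqv : q = 1 := by
    have := Int.eq_one_of_dvd_one (by rw [hq]; positivity) hq1
    exact this
  rcases Int.isUnit_iff.mp (isUnit_of_dvd_one hp1) with hp' | hp'
  · rw [hp', hqv] at hint; norm_num at hint
  · rw [hp', hqv] at hint; norm_num at hint

/-- The homogeneous form: `m³ - 8m²n + 5mn² + n³ ≠ 0` for rationals `(m, n) ≠ (0, 0)`.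
[cite: Kubert1976, Table 3 (N = 7) (the family over ℚ)] -/
theorem cube_form₇_ne_zero {m n : ℚ} (h : m ≠ 0 ∨ n ≠ 0) :
    m ^ 3 - 8 * m ^ 2 * n + 5 * m * n ^ 2 + n ^ 3 ≠ 0 := by
  intro h0
  by_cases hn : n = 0
  · subst hn
    have hm : m = 0 := pow_eq_zero_iff (n := 3) (by norm_num) |>.mp (by linear_combination h0)
    rcases h with h | h <;> contradiction
  · apply cube_sub_eight_sq_add_five_mul_add_one_ne_zero (m / n)
    field_simp
    linear_combination h0

/-- **The integral model over `ℚ` is an elliptic curve as soon as `m, n ≠ 0`, `m ≠ n`.**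
[cite: Kubert1976, Table 3 (N = 7); Knapp1993, §V.5 p. 147 (Δ(b,c))] -/
theorem isElliptic_kubertTateSeven_rat {m n : ℚ} (hm : m ≠ 0) (hn : n ≠ 0) (hmn : m ≠ n) :
    (kubertTateSeven m n).IsElliptic :=
  isElliptic_kubertTateSeven hm hn hmn (cube_form₇_ne_zero (Or.inl hm))

end Rat

end WeierstrassCurve

end
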